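import Summits.CriticalPhenomena.Ising3DConformalLimit.Theorems.EnergyNotSigmaSquaredGapForcesFarMergingRootOpacityChains
import Summits.CriticalPhenomena.Ising3DConformalLimit.Theorems.EnergyNotSigmaSquaredGapForcesFarMergingRootOpacityAvoid
import Summits.CriticalPhenomena.Ising3DConformalLimit.Theorems.EnergyNotSigmaSquaredGapForcesFarMergingRootOpacityCounting

/-! # Root opacity of the one-pinch screening ladder (stub `stub_rootOpacity`)
(line `screening-form-lemma-a1` of crux `GapForcesFarMerging`, item stmt-CriticalPhenomena-4468)

`stub_rootOpacity : OnePinchScreeningDecay → Floors → RootOpacityIO`. The counting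
(`rootOpacity_of_floors_rootFloor`, file `…RootOpacityCounting`) reduces it to a ROOT FLOOR of the ladder
at infinitely many root octaves, which is proved here for EVERY root octave `j₀` (`rootFloor`): with
`r = 2^{j₀}`, for all large `m`, eventually in the box size `n`,
`pinchScreen n r m ≥ S_{e₂,dn m}(Λ_r ∖ R) · P^{{0}∆{up m},∅}_{Λ_n}[all pairs at R closed, dn m ∉ C(0)] ≥ η₁(r)·p₀(r)`
— the screening side (`screening_mul_real_le_pinchScreen`, `screening_root_lower`: Griffiths antitonicity and
the finite energy across the hole `Λ_r`) times the current side (`rayEvent_real_ge`: the factorised ray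
cylinder probability, bounded below by finite energy again, minus the vanishing one-point density of the far
probe point, proved here: the exact one-point density `P^{{0}∆{up m},∅}_{Λ_n}[dn m ∈ C(0)] =
⟨σ_{up}σ_{dn}⟩⟨σ₀σ_{dn}⟩/⟨σ₀σ_{up}⟩` (`dnDensity_real_eq`, tree theorem
`Current.tsum_epairWeight_mul_indicator_mem_cluster`) tends to `G(2me₂)·G(dn m)/G(up m) = G(2me₂) ≤ C/(2m)`
(box limits, reflection invariance, infrared bound; `dnDensity_eventually_lt`, `rayEvent_real_ge`)).
References: Aizenman–Duminil-Copin 2021, §3.1, (3.10), Appendix A Lemma A.1; Panis 2023 §4.1;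
Aizenman–Duminil-Copin–Sidoravicius 2015, (2.13)–(2.14); Friedli–Velenik 2017, Thm. 3.20, Exercises 3.12, 3.14, 3.31. -/

noncomputable section

namespace Summit.CriticalPhenomena.Ising3DConformalLimit.EnergyNotSigmaSquaredGapForcesFarMerging

open scoped symmDiff ENNReal Topology
open MeasureTheory Filter Finset
open Literature.Probability.LatticeModels Literature.Probability.Percolation
open Summit.CriticalPhenomena.Ising3DConformalLimit.Theorems.GapForcesFarMerging.Negative (e₁ e₂ cc2 xR up dn)
open Summit.CriticalPhenomena.Ising3DConformalLimit.GapForcesFarMergingScreening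

/-! ### Pair weights in `ℝ≥0∞` at the constant coupling -/

/-- At the constant coupling `β ≥ 0` the `ℝ≥0∞` pair weight is `ofReal` of the real one. [folklore] -/
theorem epairWeight_const_eq_ofReal {V : Type*} [Fintype V] [DecidableEq V] {G : SimpleGraph V}
    [DecidableRel G.Adj] {β : ℝ} (hβ : 0 ≤ β) (A B : Finset V) (p : Current G × Current G) :
    epairWeight (fun _ : G.edgeFinset => β) A B p = ENNReal.ofReal (pairWeight G β A B p) := by
  rw [epairWeight, pairWeight]
  split_ifs with h
  · rw [Current.eweight, Current.eweight, ← Current.weight_eq_wweight, ← Current.weight_eq_wweight,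
      ENNReal.ofReal_mul (Current.weight_nonneg hβ _)]
  · rw [ENNReal.ofReal_zero]

/-! ### The one-point density of `dn m` -/

/-- **`P^{{0}∆{up m},∅}_{Λ_n}[dn m ∈ C(0)] = ⟨σ_{up}σ_{dn}⟩⟨σ₀σ_{dn}⟩/⟨σ₀σ_{up}⟩`** (box correlations at
`β_c(3)`, `n ≥ 2m`, `m ≥ 1`): the exact one-point density of the duplicated cluster, read on pairs of box
currents. [cite: AizenmanDuminilCopinAnnals2021, eq. (3.10)] -/
theorem dnDensity_real_eq {n m : ℕ} (hm : 1 ≤ m) (hn : 2 * m ≤ n) :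
    (doubleCurrentMeasure (freeBoxGraph 3 n) (criticalBeta 3) (boxSources 3 n ({0} ∆ {up m})) ∅).real
        {p | dn m ∈ openCluster (sourcedTrace 3 n p) 0} =
      isingCorr (zdGraph 3) (box 3 n) (criticalBeta 3) 0 .free ({up m} ∆ {dn m}) *
          isingCorr (zdGraph 3) (box 3 n) (criticalBeta 3) 0 .free ({0} ∆ {dn m}) /
        isingCorr (zdGraph 3) (box 3 n) (criticalBeta 3) 0 .free ({0} ∆ {up m}) := by
  classical
  have hβ : 0 < criticalBeta 3 := criticalBeta_pos_holds (d := 3) (by norm_num)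
  set β := criticalBeta 3 with hβdef
  set G := freeBoxGraph 3 n with hG
  obtain ⟨hu0, hu1, hu2⟩ := up_coords m
  obtain ⟨hd0, hd1, hd2⟩ := dn_coords m
  have h0n : (0 : Site 3) ∈ box 3 n := zero_mem_box 3 n
  have hupn : up m ∈ box 3 n := by rw [mem_box_three, hu0, hu1, hu2]; omega
  have hdnn : dn m ∈ box 3 n := by rw [mem_box_three, hd0, hd1, hd2]; omega
  set o' : BoxVertex 3 n := ⟨0, box_mono 3 (Nat.le_succ n) h0n⟩ with ho'
  set u' : BoxVertex 3 n := ⟨up m, box_mono 3 (Nat.le_succ n) hupn⟩ with hu'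
  set d' : BoxVertex 3 n := ⟨dn m, box_mono 3 (Nat.le_succ n) hdnn⟩ with hd'
  have hne : (0 : Site 3) ≠ up m := fun h => by have := congr_fun h 0; rw [hu0] at this; simp at this; omega
  have hA : boxSources 3 n (({0} : Finset (Site 3)) ∆ {up m}) = ({o'} : Finset (BoxVertex 3 n)) ∆ {u'} :=
    boxSources_pair 3 n o' u'
  -- the event read on the clusters of the sum
  set E : Set (Current G × Current G) := {p | dn m ∈ openCluster (sourcedTrace 3 n p) 0} with hE
  have hEeq : ∀ p : Current G × Current G, p ∈ E ↔ d' ∈ (p.1 + p.2).cluster o' := fun p => by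
    rw [Current.mem_cluster_iff, ← mem_tracedConn_iff, ← sourcedTrace_preimage_openConn 3 o' d']
    rfl
  -- normalisers
  have hZA : currentSum G β (({o'} : Finset (BoxVertex 3 n)) ∆ {u'}) ≠ 0 := by
    rw [← hA]
    exact (currentSum_boxSources_pos 3 hβ (symmDiff_singleton_subset_box 3 h0n hupn)
      (by rw [card_pair_symmDiff hne]; exact even_two)).ne'
  have hZ0 : 0 < currentSum G β ∅ := currentSum_empty_pos' G β
  -- the series identity in `ℝ`
  have hK : ∀ e : G.edgeFinset, 0 ≤ (fun _ : G.edgeFinset => β) e := fun _ => hβ.le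
  have hser := doubleCurrentMeasure_real_mul' G hβ.le (({o'} : Finset (BoxVertex 3 n)) ∆ {u'}) ∅ (E := E)
    (Set.to_countable _).measurableSet
  have hswitch := Current.tsum_epairWeight_mul_indicator_mem_cluster (G := G) hK o' u' d'
  have hind : ∀ p : Current G × Current G,
      epairWeight (fun _ : G.edgeFinset => β) ({o'} ∆ {u'}) ∅ p * (if d' ∈ (p.1 + p.2).cluster o' then 1 else 0) =
        ENNReal.ofReal (pairWeight G β ({o'} ∆ {u'}) ∅ p * E.indicator 1 p) := fun p => by
    rw [epairWeight_const_eq_ofReal hβ.le, Set.indicator_apply]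
    by_cases h : d' ∈ (p.1 + p.2).cluster o'
    · rw [if_pos h, if_pos ((hEeq p).2 h), Pi.one_apply, mul_one, mul_one]
    · rw [if_neg h, if_neg (fun h' => h ((hEeq p).1 h')), mul_zero, mul_zero, ENNReal.ofReal_zero]
  simp_rw [hind] at hswitch
  have hnn : ∀ p : Current G × Current G, 0 ≤ pairWeight G β ({o'} ∆ {u'}) ∅ p * E.indicator 1 p := fun p =>
    mul_nonneg (pairWeight_nonneg G hβ.le _ _ p) (by rw [Set.indicator_apply]; split_ifs <;> simp)
  have hsum : Summable fun p : Current G × Current G => pairWeight G β ({o'} ∆ {u'}) ∅ p * E.indicator 1 p :=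
    summable_pairWeight_mul G β _ _ (C := 1) fun p => by rw [Set.indicator_apply]; split_ifs <;> simp
  rw [← ENNReal.ofReal_tsum_of_nonneg hnn hsum, ecurrentSum_eq_ofReal hK, ecurrentSum_eq_ofReal hK,
    ← currentSum_eq_wcurrentSum, ← currentSum_eq_wcurrentSum,
    ← ENNReal.ofReal_mul (currentSum_nonneg G hβ.le _),
    ENNReal.ofReal_eq_ofReal_iff (tsum_nonneg hnn) (mul_nonneg (currentSum_nonneg G hβ.le _) (currentSum_nonneg G hβ.le _))]
    at hswitch
  rw [hswitch] at hser
  -- current sums as correlations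
  have hcorr : ∀ (a b : BoxVertex 3 n), (a : Site 3) ∈ box 3 n → (b : Site 3) ∈ box 3 n →
      currentSum G β ({a} ∆ {b}) = isingCorr (zdGraph 3) (box 3 n) β 0 .free ({(a : Site 3)} ∆ {(b : Site 3)}) *
        currentSum G β ∅ := fun a b ha hb => by
    rw [isingCorr_free_box_eq_currentSum_div 3 n β (symmDiff_singleton_subset_box 3 ha hb), boxSources_pair,
      div_mul_cancel₀ _ hZ0.ne']
  have hc1 : currentSum G β ({o'} ∆ {u'}) =
      isingCorr (zdGraph 3) (box 3 n) β 0 .free ({(0 : Site 3)} ∆ {up m}) * currentSum G β ∅ := hcorr o' u' h0n hupn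
  have hc2 : currentSum G β ({u'} ∆ {d'}) =
      isingCorr (zdGraph 3) (box 3 n) β 0 .free ({up m} ∆ {dn m}) * currentSum G β ∅ := hcorr u' d' hupn hdnn
  have hc3 : currentSum G β ({o'} ∆ {d'}) =
      isingCorr (zdGraph 3) (box 3 n) β 0 .free ({(0 : Site 3)} ∆ {dn m}) * currentSum G β ∅ := hcorr o' d' h0n hdnn
  rw [hc1, hc2, hc3] at hser
  have hApos : 0 < isingCorr (zdGraph 3) (box 3 n) β 0 .free ({(0 : Site 3)} ∆ {up m}) :=
    isingCorr_free_box_pos 3 hβ (symmDiff_singleton_subset_box 3 h0n hupn) (by rw [card_pair_symmDiff hne]; exact even_two)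
  rw [hA, eq_div_iff hApos.ne']
  have hZ0sq : (0 : ℝ) < currentSum G β ∅ * currentSum G β ∅ := by positivity
  apply mul_right_cancel₀ hZ0sq.ne'
  calc (doubleCurrentMeasure G β ({o'} ∆ {u'}) ∅).real E *
        isingCorr (zdGraph 3) (box 3 n) β 0 .free ({(0 : Site 3)} ∆ {up m}) * (currentSum G β ∅ * currentSum G β ∅)
      = (doubleCurrentMeasure G β ({o'} ∆ {u'}) ∅).real E *
          (isingCorr (zdGraph 3) (box 3 n) β 0 .free ({(0 : Site 3)} ∆ {up m}) * currentSum G β ∅ * currentSum G β ∅) := by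
        ring
    _ = isingCorr (zdGraph 3) (box 3 n) β 0 .free ({up m} ∆ {dn m}) * currentSum G β ∅ *
          (isingCorr (zdGraph 3) (box 3 n) β 0 .free ({(0 : Site 3)} ∆ {dn m}) * currentSum G β ∅) := hser
    _ = _ := by ring

/-! ### The limit of the density and its smallness -/

/-- `dn m` is the mirror image of `up m` in the coordinate hyperplane `{x₁ = 0}`. [folklore] -/
theorem dn_eq_update_up (m : ℕ) : dn m = Function.update (up m) 1 (-(up m 1)) := by
  obtain ⟨hu0, hu1, hu2⟩ := up_coords m
  obtain ⟨hd0, hd1, hd2⟩ := dn_coords m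
  funext i
  fin_cases i
  · simp [hu0, hd0]
  · simp [hu1, hd1]
  · simp [hu2, hd2]

/-- `dn m - up m = -(2m) e₂`. [folklore] -/
theorem dn_sub_up (m : ℕ) : dn m - up m = -(Pi.single 1 (2 * (m : ℤ)) : Site 3) := by
  obtain ⟨hu0, hu1, hu2⟩ := up_coords m
  obtain ⟨hd0, hd1, hd2⟩ := dn_coords m
  funext i
  fin_cases i
  · simp [hu0, hd0]
  · simp [hu1, hd1]; ring
  · simp [hu2, hd2]

/-- Box limits of the pair correlations at `β_c(3)`: `⟨σ_{{a}∆{b}}⟩_{Λ_n} → G(b - a)`. [cite: AizenmanDuminilCopinSidoraviciusCMP2015, Thm. 1.2] -/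
theorem tendsto_isingCorr_pair_criticalBeta (a b : Site 3) :
    Tendsto (fun n : ℕ => isingCorr (zdGraph 3) (box 3 n) (criticalBeta 3) 0 .free ({a} ∆ {b})) atTop
      (𝓝 (criticalTwoPoint 3 (b - a))) := by
  have h := tendsto_isingTwoPoint_free_box (d := 3) (criticalBeta_nonneg 3) a b
  rw [freeExpect_criticalBeta_spinMonomial (d := 3) le_rfl, criticalCorr_two_pair] at h
  simpa only [isingTwoPoint_free_eq_isingCorr_symmDiff] using h

/-- **The density of the far probe point is eventually small**: for every `ε > 0` there is `m₁` such that
for all `m ≥ m₁`, eventually in `n`, `P^{{0}∆{up m},∅}_{Λ_n}[dn m ∈ C(0)] < ε` (the limit is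
`G(2me₂)·G(dn m)/G(up m) = G(2me₂) ≤ C/(2m)`). [cite: AizenmanDuminilCopinAnnals2021, eq. (3.10)] -/
theorem dnDensity_eventually_lt {ε : ℝ} (hε : 0 < ε) :
    ∃ m₁ : ℕ, 1 ≤ m₁ ∧ ∀ m : ℕ, m₁ ≤ m → ∀ᶠ n : ℕ in atTop,
      (doubleCurrentMeasure (freeBoxGraph 3 n) (criticalBeta 3) (boxSources 3 n ({0} ∆ {up m})) ∅).real
        {p | dn m ∈ openCluster (sourcedTrace 3 n p) 0} < ε := by
  obtain ⟨c, C, hc, hb⟩ := criticalTwoPoint_bounds_holds (d := 3) le_rfl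
  -- `m₁` with `C/(2m₁) < ε`
  obtain ⟨m₁, hm₁⟩ := exists_nat_gt (max C 0 / ε)
  refine ⟨max m₁ 1, le_max_right _ _, fun m hm => ?_⟩
  have hm1 : 1 ≤ m := le_trans (le_max_right _ _) hm
  have hmpos : (0 : ℝ) < m := by exact_mod_cast hm1
  -- the limit of the density
  set Gc := criticalTwoPoint 3 with hGc
  have hGpos : ∀ x : Site 3, 0 < Gc x := fun x => by
    by_cases hx : x = 0
    · rw [hx, hGc, criticalTwoPoint_zero']; exact one_pos
    · exact lt_of_lt_of_le (mul_pos hc (Real.rpow_pos_of_pos (norm_pos_iff.2 hx) _)) (hb x hx).1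
  have hlim : Tendsto (fun n : ℕ => isingCorr (zdGraph 3) (box 3 n) (criticalBeta 3) 0 .free ({up m} ∆ {dn m}) *
      isingCorr (zdGraph 3) (box 3 n) (criticalBeta 3) 0 .free ({0} ∆ {dn m}) /
        isingCorr (zdGraph 3) (box 3 n) (criticalBeta 3) 0 .free ({0} ∆ {up m})) atTop
      (𝓝 (Gc (dn m - up m) * Gc (dn m - 0) / Gc (up m - 0))) :=
    ((tendsto_isingCorr_pair_criticalBeta _ _).mul (tendsto_isingCorr_pair_criticalBeta _ _)).div
      (tendsto_isingCorr_pair_criticalBeta _ _) (hGpos _).ne'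
  -- the value of the limit
  have hrefl : Gc (dn m) = Gc (up m) := by
    rw [dn_eq_update_up]
    exact twoPointPlus_reflection_invariant_holds (d := 3) (criticalBeta_nonneg 3) 1 (up m)
  have hval : Gc (dn m - up m) * Gc (dn m - 0) / Gc (up m - 0) = Gc (Pi.single 1 (2 * (m : ℤ))) := by
    rw [sub_zero, sub_zero, hrefl, mul_div_assoc, div_self (hGpos _).ne', mul_one, dn_sub_up, hGc,
      criticalTwoPoint_neg]
  have hsmall : Gc (Pi.single 1 (2 * (m : ℤ))) < ε := by
    have hne0 : (Pi.single 1 (2 * (m : ℤ)) : Site 3) ≠ 0 := fun h => by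
      have := congr_fun h 1; simp at this; omega
    have hnorm : ‖(Pi.single 1 (2 * (m : ℤ)) : Site 3)‖ = 2 * m := by
      rw [Pi.norm_single, Int.norm_eq_abs]; push_cast; rw [abs_of_nonneg (by positivity)]
    have hup := (hb _ hne0).2
    rw [hnorm, show -((3 : ℕ) - 2 : ℝ) = -1 by norm_num, Real.rpow_neg_one] at hup
    have hC : C ≤ max C 0 := le_max_left _ _
    have h2 : max C 0 / ε < m :=
      calc max C 0 / ε < m₁ := hm₁
        _ ≤ m := by exact_mod_cast (le_max_left m₁ 1).trans hm
    calc Gc (Pi.single 1 (2 * (m : ℤ))) ≤ C * (2 * (m : ℝ))⁻¹ := hup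
      _ ≤ max C 0 * (2 * (m : ℝ))⁻¹ := mul_le_mul_of_nonneg_right hC (by positivity)
      _ ≤ max C 0 * (m : ℝ)⁻¹ := mul_le_mul_of_nonneg_left (by
          rw [inv_le_inv₀ (by positivity) hmpos]; linarith) (le_max_right _ _)
      _ < ε := by
          rw [← div_eq_mul_inv, div_lt_iff₀ hmpos]
          calc max C 0 = max C 0 / ε * ε := by field_simp
            _ < m * ε := mul_lt_mul_of_pos_right h2 hε
            _ = ε * m := mul_comm _ _
  rw [hval] at hlim
  filter_upwards [hlim.eventually_lt_const hsmall, eventually_ge_atTop (2 * m)] with n hn hn2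
  rwa [dnDensity_real_eq hm1 hn2]

/-! ### The ray event has probability bounded below -/

/-- **The ray event is not rare**: at `β_c(3)`, for `r ≥ 1` there is `p₀(r) > 0` such that for all large
`m`, eventually in `n`, the `P^{{0}∆{up m},∅}_{Λ_n}`-probability that every pair through the ray `R` is
closed AND `dn m ∉ C(0)` is at least `p₀` (ray cylinder floor minus the vanishing density of `dn m`). [cite: AizenmanDuminilCopinAnnals2021, Appendix A, Lemma A.1] -/
theorem rayEvent_real_ge (r : ℕ) (hr : 1 ≤ r) :
    ∃ p₀ : ℝ, 0 < p₀ ∧ ∃ m₀ : ℕ, r < m₀ ∧ ∀ m : ℕ, m₀ ≤ m → ∀ᶠ n : ℕ in atTop, 2 * m ≤ n ∧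
      p₀ ≤ (doubleCurrentMeasure (freeBoxGraph 3 n) (criticalBeta 3) (boxSources 3 n ({0} ∆ {up m})) ∅).real
        {p | (∀ x ∈ (box 3 r).filter (fun x : Site 3 => x 0 = 0 ∧ x 1 = 1 ∧ 0 ≤ x 2), ∀ z : Site 3,
            s(x, z) ∉ sourcedTrace 3 n p) ∧ dn m ∉ openCluster (sourcedTrace 3 n p) 0} := by
  classical
  have hβ : 0 < criticalBeta 3 := criticalBeta_pos_holds (d := 3) (by norm_num)
  obtain ⟨p₁, hp₁, hcyl⟩ := rayCylinder_real_ge r hr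
  obtain ⟨m₁, hm₁, hdens⟩ := dnDensity_eventually_lt (half_pos hp₁)
  refine ⟨p₁ / 2, half_pos hp₁, max m₁ (r + 1), lt_of_lt_of_le (Nat.lt_succ_self r) (le_max_right _ _),
    fun m hm => ?_⟩
  have hmr : r < m := lt_of_lt_of_le (Nat.lt_succ_self r) ((le_max_right _ _).trans hm)
  filter_upwards [hdens m ((le_max_left _ _).trans hm), eventually_ge_atTop (2 * m)] with n hdn hn
  refine ⟨hn, ?_⟩
  set μ := doubleCurrentMeasure (freeBoxGraph 3 n) (criticalBeta 3) (boxSources 3 n ({0} ∆ {up m})) ∅ with hμ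
  set R : Finset (Site 3) := (box 3 r).filter fun x : Site 3 => x 0 = 0 ∧ x 1 = 1 ∧ 0 ≤ x 2 with hR
  set Cyl : Set (Current (freeBoxGraph 3 n) × Current (freeBoxGraph 3 n)) :=
    {p | ∀ e ∈ edgesTouching (zdGraph 3) R, e ∉ sourcedTrace 3 n p} with hCyl
  set Conn : Set (Current (freeBoxGraph 3 n) × Current (freeBoxGraph 3 n)) :=
    {p | dn m ∈ openCluster (sourcedTrace 3 n p) 0} with hConn
  set E : Set (Current (freeBoxGraph 3 n) × Current (freeBoxGraph 3 n)) :=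
    {p | (∀ x ∈ R, ∀ z : Site 3, s(x, z) ∉ sourcedTrace 3 n p) ∧ dn m ∉ openCluster (sourcedTrace 3 n p) 0} with hE
  -- `μ` is a probability measure
  obtain ⟨hu0, hu1, hu2⟩ := up_coords m
  have hupn : up m ∈ box 3 n := by rw [mem_box_three, hu0, hu1, hu2]; omega
  have hne : (0 : Site 3) ≠ up m := fun h => by have := congr_fun h 0; rw [hu0] at this; simp at this; omega
  haveI : IsProbabilityMeasure μ := isProbabilityMeasure_doubleCurrentMeasure_holds _ hβ.le
    (currentSum_boxSources_pos 3 hβ (symmDiff_singleton_subset_box 3 (zero_mem_box 3 n) hupn)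
      (by rw [card_pair_symmDiff hne]; exact even_two)).ne' (currentSum_empty_pos' _ _).ne'
  -- `Cyl ⊆ E ∪ Conn`
  have hsub : Cyl ⊆ E ∪ Conn := fun p hp => by
    by_cases hc : p ∈ Conn
    · exact Or.inr hc
    · exact Or.inl ⟨ray_closed_of_cylinder hp, hc⟩
  have h1 : p₁ ≤ μ.real Cyl := hcyl m hmr n hn
  have h2 : μ.real Cyl ≤ μ.real E + μ.real Conn :=
    (measureReal_mono hsub (measure_ne_top μ _)).trans (measureReal_union_le E Conn)
  change μ.real Conn < p₁ / 2 at hdn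
  linarith
/-! ### The root floor and the stub -/

/-- **ROOT FLOOR of the one-pinch screening ladder**: for every root octave `j₀` there is `η > 0` such that
for all large far scales `m`, eventually in the box size, `pinchScreen n (2^{j₀}) m ≥ η` — the duplicated
cluster of the strand `0 → up m` explored inside `Λ_{2^{j₀}}` screens the probe pair `(e₂, dn m)` by at most
a bounded factor with probability bounded below (ray event), uniformly in `m`. [cite: AizenmanDuminilCopinAnnals2021, Appendix A, Lemma A.1] -/
theorem rootFloor (j₀ : ℕ) :
    ∃ η : ℝ, 0 < η ∧ ∀ᶠ m : ℕ in atTop, ∀ᶠ n : ℕ in atTop, η ≤ pinchScreen n (2 ^ j₀) m := by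
  have hr : 1 ≤ 2 ^ j₀ := Nat.one_le_two_pow
  obtain ⟨η₁, hη₁, hs⟩ := screening_root_lower (2 ^ j₀) hr
  obtain ⟨p₀, hp₀, m₀, hm₀, hev⟩ := rayEvent_real_ge (2 ^ j₀) hr
  refine ⟨η₁ * p₀, mul_pos hη₁ hp₀, ?_⟩
  filter_upwards [eventually_ge_atTop m₀] with m hm
  have hrm : 2 ^ j₀ < m := lt_of_lt_of_le hm₀ hm
  filter_upwards [hev m hm] with n hn
  obtain ⟨hn, hE⟩ := hn
  have h1 := hs m hrm n hn
  have h2 := screening_mul_real_le_pinchScreen (r := 2 ^ j₀) hr hrm hn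
  exact (mul_le_mul h1 hE hp₀.le (hη₁.le.trans h1)).trans h2

/-- **S4 — ROOT OPACITY (registered stub `stub_rootOpacity`)**: one-pinch screening decay and the floors
force, for infinitely many octaves `k` inside a doubling window of the critical two-point function, a far
scale `m ≥ 2^{k+3}` with a relative screening drop `A(2^{k+1};m) ≤ (1-c)A(2^k;m)`, `A(2^k;m) > 0`, for
infinitely many box sizes: the counting `rootOpacity_of_floors_rootFloor` fed with the root floor
`rootFloor` at every root octave. [cite: AizenmanDuminilCopinAnnals2021, Appendix A, Lemma A.1] -/
theorem stub_rootOpacity : OnePinchScreeningDecay → Floors → RootOpacityIO := fun hD hF =>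
  rootOpacity_of_floors_rootFloor (Filter.Eventually.of_forall rootFloor).frequently hD hF

end Summit.CriticalPhenomena.Ising3DConformalLimit.EnergyNotSigmaSquaredGapForcesFarMerging

end
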